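import Mathlib
import HarnessLib

/-!
# The Huber penalty function and the three equivalent robust least-squares problems
(Boyd–Vandenberghe, *Convex Optimization*, §6.1.2 (6.4) and Exercise 4.5)

Source: S. Boyd, L. Vandenberghe, *Convex Optimization*, Cambridge University Press (2004)
[cite: BoydVandenberghe2004] — open copy read: §6.1.2 "Penalty function approximation",
eq. (6.4) (p. 299), the robust least-squares or **Huber penalty function**
`φ_hub(u) = u²` for `|u| ≤ M`, `= M(2|u| − M)` for `|u| > M`, "least-squares for small residuals,
`ℓ₁`-like linear growth for large ones"; and Exercise 4.5 (p. 190) "Equivalent convex problems":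
(a) `minimize ∑ φ_hub(aᵢᵀx − bᵢ)`, (b) the least-squares problem with variable weights
`minimize ∑ (aᵢᵀx − bᵢ)²/(wᵢ + 1) + M²1ᵀw, w ⪰ 0`, (c) the QP
`minimize ∑ (uᵢ² + 2Mvᵢ)` s.t. `−u − v ⪯ Ax − b ⪯ u + v, 0 ⪯ u ⪯ M1, v ⪰ 0` are equivalent.

## What is proved

Scalar identities behind the exercise, each as an attained infimum (`IsLeast`):
`φ_hub(r) = min_{w ≥ 0} r²/(w + 1) + M²w` (at `w = (|r|/M − 1)₊`) and
`φ_hub(r) = min {u² + 2Mv | |r| ≤ u + v, 0 ≤ u ≤ M, 0 ≤ v}` (at `u = min(|r|, M)`,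
`v = (|r| − M)₊`); the dual description `φ_hub(r) = max_{|c| ≤ M} (2cr − c²)` (a supremum of
affine functions, whence convexity of `φ_hub`, and the bounds `M(2|r| − M) ≤ φ_hub(r) ≤ r²`);
the summed versions for a residual vector; and the equivalence of (a), (b), (c) for an arbitrary
residual map `x ↦ r(x)` (for the exercise, `r(x) = Ax − b`): equal optimal values and the explicit
passage between minimisers.  Nothing on the Huber penalty was in the tree before this file.
-/

namespace Literature.Analysis.Convex.HuberPenalty

open Set

noncomputable section

/-! ## The Huber penalty (6.4) -/

/-- The Huber penalty function `φ_hub` with threshold `M` (6.4).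
[cite: BoydVandenberghe2004, §6.1.2 (6.4)] -/
def huber (M u : ℝ) : ℝ := if |u| ≤ M then u ^ 2 else M * (2 * |u| - M)

/-- [cite: BoydVandenberghe2004, §6.1.2 (6.4)] -/
theorem huber_of_abs_le {M u : ℝ} (h : |u| ≤ M) : huber M u = u ^ 2 := if_pos h

/-- [cite: BoydVandenberghe2004, §6.1.2 (6.4)] -/
theorem huber_of_lt_abs {M u : ℝ} (h : M < |u|) : huber M u = M * (2 * |u| - M) :=
  if_neg (not_le.mpr h)

/-- `φ_hub` is even. [cite: BoydVandenberghe2004, §6.1.2 (6.4)] -/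
theorem huber_neg (M u : ℝ) : huber M (-u) = huber M u := by simp [huber, abs_neg]

/-- `φ_hub` depends on `u` only through `|u|`. [cite: BoydVandenberghe2004, §6.1.2 (6.4)] -/
theorem huber_abs (M u : ℝ) : huber M |u| = huber M u := by simp [huber, abs_abs]

/-! ## The dual description `φ_hub(r) = max_{|c| ≤ M} (2cr − c²)` and its consequences -/

/-- `2cr − c² ≤ φ_hub(r)` for `|c| ≤ M`. [cite: BoydVandenberghe2004, §6.1.2 (6.4)] -/
theorem affine_le_huber {M c : ℝ} (hc : |c| ≤ M) (r : ℝ) : 2 * c * r - c ^ 2 ≤ huber M r := by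
  have hcr : c * r ≤ |c| * |r| := by rw [← abs_mul]; exact le_abs_self _
  by_cases h : |r| ≤ M
  · rw [huber_of_abs_le h]; nlinarith [sq_nonneg (c - r), sq_abs r]
  · rw [huber_of_lt_abs (not_le.mp h)]
    nlinarith [abs_nonneg c, abs_nonneg r, sq_abs c]

/-- **`φ_hub(r) = max {2cr − c² | |c| ≤ M}`**, attained at `c = r` (`|r| ≤ M`) resp.
`c = ±M`: the Huber penalty is a pointwise maximum of affine functions of `r`.
[cite: BoydVandenberghe2004, §6.1.2 (6.4)] -/
theorem isGreatest_affine_huber {M : ℝ} (hM : 0 ≤ M) (r : ℝ) :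
    IsGreatest ((fun c => 2 * c * r - c ^ 2) '' Icc (-M) M) (huber M r) := by
  refine ⟨?_, by rintro _ ⟨c, hc, rfl⟩; exact affine_le_huber (abs_le.mpr hc) r⟩
  by_cases h : |r| ≤ M
  · exact ⟨r, abs_le.mp h, by rw [huber_of_abs_le h]; ring⟩
  · have hr : M < |r| := not_le.mp h
    rcases le_or_gt 0 r with hr0 | hr0
    · refine ⟨M, ⟨by linarith, le_rfl⟩, ?_⟩
      simp only; rw [huber_of_lt_abs hr, abs_of_nonneg hr0]; ring
    · refine ⟨-M, ⟨le_rfl, by linarith⟩, ?_⟩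
      simp only; rw [huber_of_lt_abs hr, abs_of_neg hr0]; ring

/-- `φ_hub` is convex (a supremum of affine functions). [cite: BoydVandenberghe2004, §6.1.2] -/
theorem convexOn_huber {M : ℝ} (hM : 0 ≤ M) : ConvexOn ℝ univ (huber M) := by
  refine ⟨convex_univ, fun x _ y _ a b ha hb hab => ?_⟩
  obtain ⟨⟨c, hc, hcx⟩, -⟩ := isGreatest_affine_huber hM (a • x + b • y)
  have hc' : |c| ≤ M := abs_le.mpr hc
  simp only [smul_eq_mul] at hcx ⊢
  rw [← hcx]
  have h1 := affine_le_huber hc' x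
  have h2 := affine_le_huber hc' y
  have : 2 * c * (a * x + b * y) - c ^ 2 = a * (2 * c * x - c ^ 2) + b * (2 * c * y - c ^ 2) := by
    linear_combination c ^ 2 * hab
  rw [this]
  nlinarith

/-- `φ_hub(r) ≤ r²` ("agrees with least-squares for small residuals" and lies below it beyond).
[cite: BoydVandenberghe2004, §6.1.2 (6.4)] -/
theorem huber_le_sq (M r : ℝ) : huber M r ≤ r ^ 2 := by
  by_cases h : |r| ≤ M
  · rw [huber_of_abs_le h]
  · rw [huber_of_lt_abs (not_le.mp h)]; nlinarith [sq_nonneg (|r| - M), sq_abs r]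

/-- `M(2|r| − M) ≤ φ_hub(r)` (the linear branch is a global minorant).
[cite: BoydVandenberghe2004, §6.1.2 (6.4)] -/
theorem linear_le_huber (M r : ℝ) : M * (2 * |r| - M) ≤ huber M r := by
  by_cases h : |r| ≤ M
  · rw [huber_of_abs_le h]; nlinarith [sq_nonneg (|r| - M), sq_abs r]
  · rw [huber_of_lt_abs (not_le.mp h)]

/-- `0 ≤ φ_hub`. [cite: BoydVandenberghe2004, §6.1.2 (6.4)] -/
theorem huber_nonneg {M : ℝ} (hM : 0 ≤ M) (r : ℝ) : 0 ≤ huber M r := by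
  simpa using affine_le_huber (c := 0) (by simpa using hM) r

/-- `φ_hub` is monotone in `|r|`. [cite: BoydVandenberghe2004, §6.1.2 (6.4)] -/
theorem huber_mono_abs {M : ℝ} (hM : 0 ≤ M) {r s : ℝ} (h : |r| ≤ |s|) : huber M r ≤ huber M s := by
  obtain ⟨⟨c, hc, hcr⟩, -⟩ := isGreatest_affine_huber hM r
  simp only at hcr
  -- replace `c` by `|c| sign(s)`-free argument: use `c' = |c|` against `|s|`
  have hc' : |(|c|)| ≤ M := by rw [abs_abs]; exact abs_le.mpr hc
  have h1 : 2 * c * r - c ^ 2 ≤ 2 * |c| * |s| - |c| ^ 2 := by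
    have : c * r ≤ |c| * |s| :=
      calc c * r ≤ |c * r| := le_abs_self _
        _ = |c| * |r| := abs_mul c r
        _ ≤ |c| * |s| := by gcongr
    nlinarith [sq_abs c]
  rw [← hcr]
  exact h1.trans ((affine_le_huber hc' |s|).trans_eq (huber_abs M s))

/-! ## Exercise 4.5 (b): `φ_hub(r) = min_{w ≥ 0} r²/(w + 1) + M²w` -/

/-- The objective of (b) for one residual. [cite: BoydVandenberghe2004, Exercise 4.5] -/
def huberWt (M r w : ℝ) : ℝ := r ^ 2 / (w + 1) + M ^ 2 * w

/-- The optimal weight adjustment `w⋆ = (|r|/M − 1)₊`. [cite: BoydVandenberghe2004, Exercise 4.5] -/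
def huberW (M r : ℝ) : ℝ := max (|r| / M - 1) 0

/-- [cite: BoydVandenberghe2004, Exercise 4.5] -/
theorem huberW_nonneg (M r : ℝ) : 0 ≤ huberW M r := le_max_right _ _

/-- Lower bound: `φ_hub(r) ≤ r²/(w + 1) + M²w` for every `w ≥ 0`.
[cite: BoydVandenberghe2004, Exercise 4.5] -/
theorem huber_le_huberWt {M : ℝ} (hM : 0 < M) (r : ℝ) {w : ℝ} (hw : 0 ≤ w) :
    huber M r ≤ huberWt M r w := by
  have hs : 0 < w + 1 := by linarith
  unfold huberWt
  rw [div_add' _ _ _ hs.ne', le_div_iff₀ hs]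
  by_cases h : |r| ≤ M
  · rw [huber_of_abs_le h]
    have : r ^ 2 ≤ M ^ 2 := by nlinarith [abs_nonneg r, sq_abs r]
    nlinarith [mul_le_mul_of_nonneg_right this hw, mul_nonneg (mul_nonneg (sq_nonneg M) hw) hw]
  · rw [huber_of_lt_abs (not_le.mp h)]
    nlinarith [sq_nonneg (|r| - M * (w + 1)), sq_abs r]

/-- Attainment at `w⋆`. [cite: BoydVandenberghe2004, Exercise 4.5] -/
theorem huberWt_huberW {M : ℝ} (hM : 0 < M) (r : ℝ) : huberWt M r (huberW M r) = huber M r := by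
  unfold huberWt huberW
  by_cases h : |r| ≤ M
  · rw [max_eq_right (by rw [sub_nonpos, div_le_one hM]; exact h), huber_of_abs_le h]; simp
  · have hr : M < |r| := not_le.mp h
    rw [max_eq_left (by rw [sub_nonneg, one_le_div hM]; exact hr.le), huber_of_lt_abs hr,
      show |r| / M - 1 + 1 = |r| / M by ring, ← sq_abs r]
    have hr0 : |r| ≠ 0 := (hM.trans hr).ne'
    have hM0 : M ≠ 0 := hM.ne'
    rw [show |r| ^ 2 / (|r| / M) = |r| * M by field_simp]
    field_simp
    ring

/-- **(b) for one residual**: `φ_hub(r) = min_{w ≥ 0} r²/(w + 1) + M²w`.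
[cite: BoydVandenberghe2004, Exercise 4.5] -/
theorem isLeast_huberWt {M : ℝ} (hM : 0 < M) (r : ℝ) :
    IsLeast (huberWt M r '' Ici 0) (huber M r) :=
  ⟨⟨huberW M r, huberW_nonneg M r, huberWt_huberW hM r⟩,
    by rintro _ ⟨w, hw, rfl⟩; exact huber_le_huberWt hM r hw⟩

/-! ## Exercise 4.5 (c): `φ_hub(r) = min {u² + 2Mv | |r| ≤ u + v, 0 ≤ u ≤ M, 0 ≤ v}` -/

/-- The objective of (c) for one residual. [cite: BoydVandenberghe2004, Exercise 4.5] -/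
def huberQP (M u v : ℝ) : ℝ := u ^ 2 + 2 * M * v

/-- The constraints of (c) for one residual: `−u − v ≤ r ≤ u + v`, `0 ≤ u ≤ M`, `0 ≤ v`.
[cite: BoydVandenberghe2004, Exercise 4.5] -/
def HuberQPFeasible (M r u v : ℝ) : Prop := |r| ≤ u + v ∧ 0 ≤ u ∧ u ≤ M ∧ 0 ≤ v

/-- The optimal `u⋆ = min(|r|, M)`. [cite: BoydVandenberghe2004, Exercise 4.5] -/
def huberU (M r : ℝ) : ℝ := min |r| M

/-- The optimal `v⋆ = (|r| − M)₊`. [cite: BoydVandenberghe2004, Exercise 4.5] -/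
def huberV (M r : ℝ) : ℝ := max (|r| - M) 0

/-- [cite: BoydVandenberghe2004, Exercise 4.5] -/
theorem huberQPFeasible_opt {M : ℝ} (hM : 0 ≤ M) (r : ℝ) :
    HuberQPFeasible M r (huberU M r) (huberV M r) := by
  refine ⟨?_, le_min (abs_nonneg r) hM, min_le_right _ _, le_max_right _ _⟩
  unfold huberU huberV
  rcases le_total |r| M with h | h
  · rw [min_eq_left h, max_eq_right (sub_nonpos.mpr h)]; simp
  · rw [min_eq_right h, max_eq_left (sub_nonneg.mpr h)]; linarith

/-- Lower bound: `φ_hub(r) ≤ u² + 2Mv` on the feasible set of (c).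
[cite: BoydVandenberghe2004, Exercise 4.5] -/
theorem huber_le_huberQP {M r u v : ℝ} (h : HuberQPFeasible M r u v) :
    huber M r ≤ huberQP M u v := by
  obtain ⟨hr, hu0, huM, hv⟩ := h
  unfold huberQP
  by_cases hrM : |r| ≤ M
  · rw [huber_of_abs_le hrM, ← sq_abs r]
    by_cases hru : |r| ≤ u
    · nlinarith [abs_nonneg r]
    · -- `u < |r| ≤ M`: `u² + 2M(|r| − u) ≥ |r|²`
      nlinarith [abs_nonneg r, not_le.mp hru]
  · rw [huber_of_lt_abs (not_le.mp hrM)]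
    nlinarith [not_le.mp hrM, sq_nonneg (M - u)]

/-- Attainment at `(u⋆, v⋆)`. [cite: BoydVandenberghe2004, Exercise 4.5] -/
theorem huberQP_opt (M r : ℝ) : huberQP M (huberU M r) (huberV M r) = huber M r := by
  unfold huberQP huberU huberV
  by_cases h : |r| ≤ M
  · rw [min_eq_left h, max_eq_right (sub_nonpos.mpr h), huber_of_abs_le h, sq_abs]; ring
  · have h' := (not_le.mp h).le
    rw [min_eq_right h', max_eq_left (sub_nonneg.mpr h'), huber_of_lt_abs (not_le.mp h)]; ring

/-- **(c) for one residual**: `φ_hub(r) = min {u² + 2Mv | |r| ≤ u + v, 0 ≤ u ≤ M, 0 ≤ v}`.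
[cite: BoydVandenberghe2004, Exercise 4.5] -/
theorem isLeast_huberQP {M : ℝ} (hM : 0 ≤ M) (r : ℝ) :
    IsLeast {t | ∃ u v, HuberQPFeasible M r u v ∧ t = huberQP M u v} (huber M r) :=
  ⟨⟨huberU M r, huberV M r, huberQPFeasible_opt hM r, (huberQP_opt M r).symm⟩,
    by rintro _ ⟨u, v, h, rfl⟩; exact huber_le_huberQP h⟩

/-! ## The three problems for a residual vector and their equivalence -/

section Problems

variable {ι : Type*} [Fintype ι] {X : Type*}

/-- (a) `∑ φ_hub(rᵢ)`. [cite: BoydVandenberghe2004, Exercise 4.5] -/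
def huberObjA (M : ℝ) (r : ι → ℝ) : ℝ := ∑ i, huber M (r i)

/-- (b) `∑ rᵢ²/(wᵢ + 1) + M²1ᵀw`. [cite: BoydVandenberghe2004, Exercise 4.5] -/
def huberObjB (M : ℝ) (r w : ι → ℝ) : ℝ := ∑ i, (r i) ^ 2 / (w i + 1) + M ^ 2 * ∑ i, w i

/-- (c) `∑ (uᵢ² + 2Mvᵢ)`. [cite: BoydVandenberghe2004, Exercise 4.5] -/
def huberObjC (M : ℝ) (u v : ι → ℝ) : ℝ := ∑ i, ((u i) ^ 2 + 2 * M * v i)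

/-- [cite: BoydVandenberghe2004, Exercise 4.5] -/
theorem huberObjB_eq_sum (M : ℝ) (r w : ι → ℝ) : huberObjB M r w = ∑ i, huberWt M (r i) (w i) := by
  simp [huberObjB, huberWt, Finset.sum_add_distrib, Finset.mul_sum]

/-- (a) ≤ (b) pointwise, with equality at `w⋆`. [cite: BoydVandenberghe2004, Exercise 4.5] -/
theorem huberObjA_le_huberObjB {M : ℝ} (hM : 0 < M) (r : ι → ℝ) {w : ι → ℝ} (hw : 0 ≤ w) :
    huberObjA M r ≤ huberObjB M r w := by
  rw [huberObjB_eq_sum]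
  exact Finset.sum_le_sum fun i _ => huber_le_huberWt hM (r i) (hw i)

/-- [cite: BoydVandenberghe2004, Exercise 4.5] -/
theorem huberObjB_huberW {M : ℝ} (hM : 0 < M) (r : ι → ℝ) :
    huberObjB M r (fun i => huberW M (r i)) = huberObjA M r := by
  rw [huberObjB_eq_sum]; exact Finset.sum_congr rfl fun i _ => huberWt_huberW hM (r i)

/-- (a) ≤ (c) on the feasible set, with equality at `(u⋆, v⋆)`.
[cite: BoydVandenberghe2004, Exercise 4.5] -/
theorem huberObjA_le_huberObjC {M : ℝ} (r : ι → ℝ) {u v : ι → ℝ}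
    (h : ∀ i, HuberQPFeasible M (r i) (u i) (v i)) :
    huberObjA M r ≤ huberObjC M u v :=
  Finset.sum_le_sum fun i _ => huber_le_huberQP (h i)

/-- [cite: BoydVandenberghe2004, Exercise 4.5] -/
theorem huberObjC_opt (M : ℝ) (r : ι → ℝ) :
    huberObjC M (fun i => huberU M (r i)) (fun i => huberV M (r i)) = huberObjA M r :=
  Finset.sum_congr rfl fun i _ => huberQP_opt M (r i)

/-- Partial minimisation: if `g(x) = min_w F(x, w)` over `{w | S x w}`, attained at `w = σ(x)`,
then `x₀` minimises `g` iff `(x₀, σ x₀)` minimises `F` over `{(x, w) | S x w}` ("carefully explain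
how the solution of each problem is obtained from the solution of the other").
[cite: BoydVandenberghe2004, Exercise 4.5] -/
theorem isMinOn_iff_of_partialMin {W : Type*} {g : X → ℝ} {F : X × W → ℝ} {S : X → W → Prop}
    {σ : X → W} (hle : ∀ x w, S x w → g x ≤ F (x, w)) (hσ : ∀ x, S x (σ x))
    (heq : ∀ x, F (x, σ x) = g x) (x₀ : X) :
    IsMinOn g univ x₀ ↔ IsMinOn F {p | S p.1 p.2} (x₀, σ x₀) := by
  constructor
  · intro h p hp
    simp only [mem_setOf_eq] at hp ⊢
    rw [heq]
    exact (h (mem_univ p.1)).trans (hle p.1 p.2 hp)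
  · intro h x _
    have := h (show (x, σ x) ∈ {p : X × W | S p.1 p.2} from hσ x)
    simp only [mem_setOf_eq, heq] at this
    exact this

/-- **(a) ⇔ (b)**: `x⋆` solves the Huber problem iff `(x⋆, w⋆)` with `wᵢ⋆ = (|rᵢ(x⋆)|/M − 1)₊`
solves the variable-weights problem. [cite: BoydVandenberghe2004, Exercise 4.5] -/
theorem isMinOn_huberObjA_iff_huberObjB {M : ℝ} (hM : 0 < M) (r : X → ι → ℝ) (x₀ : X) :
    IsMinOn (fun x => huberObjA M (r x)) univ x₀ ↔
      IsMinOn (fun p : X × (ι → ℝ) => huberObjB M (r p.1) p.2) {p | 0 ≤ p.2}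
        (x₀, fun i => huberW M (r x₀ i)) :=
  isMinOn_iff_of_partialMin (S := fun _ w => 0 ≤ w)
    (fun x _ hw => huberObjA_le_huberObjB hM (r x) hw)
    (fun x i => huberW_nonneg M (r x i)) (fun x => huberObjB_huberW hM (r x)) x₀

/-- **(a) ⇔ (c)**: `x⋆` solves the Huber problem iff `(x⋆, u⋆, v⋆)` with `uᵢ⋆ = min(|rᵢ(x⋆)|, M)`,
`vᵢ⋆ = (|rᵢ(x⋆)| − M)₊` solves the QP. [cite: BoydVandenberghe2004, Exercise 4.5] -/
theorem isMinOn_huberObjA_iff_huberObjC {M : ℝ} (hM : 0 ≤ M) (r : X → ι → ℝ) (x₀ : X) :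
    IsMinOn (fun x => huberObjA M (r x)) univ x₀ ↔
      IsMinOn (fun p : X × ((ι → ℝ) × (ι → ℝ)) => huberObjC M p.2.1 p.2.2)
        {p | ∀ i, HuberQPFeasible M (r p.1 i) (p.2.1 i) (p.2.2 i)}
        (x₀, fun i => huberU M (r x₀ i), fun i => huberV M (r x₀ i)) :=
  isMinOn_iff_of_partialMin (F := fun p : X × ((ι → ℝ) × (ι → ℝ)) => huberObjC M p.2.1 p.2.2)
    (S := fun x uv => ∀ i, HuberQPFeasible M (r x i) (uv.1 i) (uv.2 i))
    (σ := fun x => (fun i => huberU M (r x i), fun i => huberV M (r x i)))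
    (fun x _ huv => huberObjA_le_huberObjC (r x) huv) (fun x i => huberQPFeasible_opt hM (r x i))
    (fun x => huberObjC_opt M (r x)) x₀

/-- Equal optimal values of (a) and (b): the same lower bounds.
[cite: BoydVandenberghe2004, Exercise 4.5] -/
theorem lowerBounds_huberObjA_eq_huberObjB {M : ℝ} (hM : 0 < M) (r : X → ι → ℝ) :
    lowerBounds (range fun x => huberObjA M (r x)) =
      lowerBounds ((fun p : X × (ι → ℝ) => huberObjB M (r p.1) p.2) '' {p | 0 ≤ p.2}) := by
  ext B; simp only [mem_lowerBounds, forall_mem_range, forall_mem_image, mem_setOf_eq]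
  constructor
  · exact fun h p hp => (h p.1).trans (huberObjA_le_huberObjB hM (r p.1) hp)
  · intro h x
    simpa [huberObjB_huberW hM] using
      @h (x, fun i => huberW M (r x i)) (fun i => huberW_nonneg M (r x i))

/-- Equal optimal values of (a) and (c). [cite: BoydVandenberghe2004, Exercise 4.5] -/
theorem lowerBounds_huberObjA_eq_huberObjC {M : ℝ} (hM : 0 ≤ M) (r : X → ι → ℝ) :
    lowerBounds (range fun x => huberObjA M (r x)) =
      lowerBounds ((fun p : X × ((ι → ℝ) × (ι → ℝ)) => huberObjC M p.2.1 p.2.2) ''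
        {p | ∀ i, HuberQPFeasible M (r p.1 i) (p.2.1 i) (p.2.2 i)}) := by
  ext B; simp only [mem_lowerBounds, forall_mem_range, forall_mem_image, mem_setOf_eq]
  constructor
  · exact fun h p hp => (h p.1).trans (huberObjA_le_huberObjC (r p.1) hp)
  · intro h x
    simpa [huberObjC_opt] using
      @h (x, fun i => huberU M (r x i), fun i => huberV M (r x i))
        (fun i => huberQPFeasible_opt hM (r x i))

end Problems

end

end Literature.Analysis.Convex.HuberPenalty
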